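import Summits.AnomalousDissipation.AnomalousDissipation.Theses.SawtoothPulseCascade

/-!
# `SawtoothPulseCascade.Assembly` (stmt-AnomalousDissipation-19497): the route thesis as one implication

Route `AnomalousDissipation/SawtoothPulseCascade`, assembly item `Assembly` (rev 8):
`K1LocalisedCascade → K2LinearisedCascadeGrowth → K3LocalisedClosure → Target`.
Since `K3LocalisedClosure` is, by definition, the implication
`K1LocalisedCascade → K2LinearisedCascadeGrowth → Target`, the item is modus ponens: given the
localised scalar crux `hK1`, the linearised per-phase Kelvin–Helmholtz cap `hK2` and the localised
closure `hK3`, the Target is `hK3 hK1 hK2` (the same term as the route's deciding theorem `closes`).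
No mathematics beyond pure logic is used.
-/

-- `Summit.<Summit>.<Problem>` is the tree's mandated summit-side namespace (CONVENTIONS §2); for this
-- single-conjunct summit the two coincide, so the duplicate is deliberate (lakefile: off for `Summits`).
set_option linter.dupNamespace false

namespace Summit.AnomalousDissipation.AnomalousDissipation.Theorems

/-- Closes the route assembly item `Assembly` (stmt-AnomalousDissipation-19497):
`K1LocalisedCascade → K2LinearisedCascadeGrowth → K3LocalisedClosure → Target` — modus ponens, since
`K3LocalisedClosure` unfolds to `K1LocalisedCascade → K2LinearisedCascadeGrowth → Target`. -/
theorem sawtoothPulseCascade_assembly_proof :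
    Summit.AnomalousDissipation.AnomalousDissipation.Theses.SawtoothPulseCascade.Assembly := by
  unfold Summit.AnomalousDissipation.AnomalousDissipation.Theses.SawtoothPulseCascade.Assembly
  intro hK1 hK2 hK3
  exact hK3 hK1 hK2

end Summit.AnomalousDissipation.AnomalousDissipation.Theorems
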